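import Literature.Probability.FitznerVanDerHofstad2017.NobleInstantiate
import Literature.Probability.FitznerVanDerHofstad2017.BoundMapMonotone
import Literature.Barriers.CriticalPhenomena.LaceExpansionNobleContinuity
import HarnessLib

/-!
# [NoBLE17] Assumptions 4.1–4.3 for percolation, typed over the tree's NoBLE coefficients, and Prop. 4.5(ii)

Reproduction module (build `lace`, LEAN-IN-TREE RULE, PLACEMENT v2) in the package of
R. Fitzner, R. van der Hofstad, *Mean-field behavior for nearest-neighbor percolation in `d > 10`*,
Electron. J. Probab. **22** (2017) no. 43 [FvdH17], companion of
R. Fitzner, R. van der Hofstad, *Generalized approach to the non-backtracking lace expansion*,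
Probab. Theory Relat. Fields **169** (2017) 1041–1119 [NoBLE17] (= [FitHof13b], arXiv:1506.07969).

## What this module does

The oracle binder of the certificate chain, `NobleImprovementInputsAt d cμ c Γ B b`
(`NobleInstantiate.lean`), asks for the *simplified NoBLE form with the Assumption 2.7 bounds*
`NobleSimplifiedFormAt d p B` at every `p ∈ (p_I, p_c)` with `f_i(p) ≤ Γ_i`.  In the papers this is
obtained in two moves:

1. [NoBLE17] **Prop. 4.5(ii)** (p. 1088; proof = Appendix D, pp. 1110–1118): Assumptions 4.1–4.3 on the
   NoBLE COEFFICIENTS `Ξ^{(N)}, Ξ^{(N),ι}, Ψ^{(N),κ}, Π^{(N),ι,κ}` and on the model-dependent SPLIT of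
   §4.1.1 imply Assumption 2.7, with the `β`'s of Assumption 2.7 given by the explicit formulas
   (D.1)–(D.32) — the map typed in `BetaMap.lean` (`BetaMap.nobleBetaOfInputs`);
2. [FvdH17] §4 (Prop. 2.2 / Assumption "5.7"): for percolation, Assumptions 4.1–4.3 hold on `(p_I, p_c)`
   under `f_i(p) ≤ Γ_i`, with constants computed from `Γ` and simple-random-walk integrals
   (the notebook `Percolation.nb`; STEP 2 of GAPS.md G8, other seats).

This file types move 1 for percolation:

* `NobleSplit d p` — the DATA of the split of [NoBLE17] §4.1.1 (pp. 1080–1081): non-negative functions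
  `Ξ_α^{(N)}, Ψ_{α,I}^{(N),ι}, Ψ_{α,II}^{(N),ι}` (`N = 0,1`), `Ξ_{α,I}^{(0),ι}, Ξ_{α,II}^{(0),ι}, Π_α^{(0),ι,κ}`
  dominated by the tree coefficients (so that the remainders `Ξ_R := Ξ − Ξ_α`, … are non-negative) and
  supported as printed; the remainders are DEFINED as the differences (as [FvdH17] §4.1 does:
  "we define the remainder terms by `Ξ_R := Ξ − Ξ_α`").
* `NobleAssumption41At d p S` — (4.26)–(4.28): reflection symmetry, total rotational symmetry
  (Def. 2.5, `IsTRS`) of the coefficient sums and of the remainder sums, exchangeability of directions.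
* `NobleAssumption42At d p` — (4.29) with `μ̄_p = p`, `μ_p = nobleMu d p` ([FvdH17] (1.26)/(2.18)):
  `Ψ^{(N),κ}_p(x) ≤ (p/μ_p) Ξ^{(N)}_p(x)`, `Π^{(N),ι,κ}_p(x) ≤ p Ξ^{(N),ι}_p(x)` — **PROVED** for
  `0 < p < p_c`, `d ≥ 2` (`nobleAssumption42At_of_lt_criticalProbI`) from the tree theorems
  `noblePsiN_le`, `noblePiN_le` of `LaceExpansionNobleCoefficients.lean` and the finiteness of the
  coefficients below `p_c` (`nobleXiBT_ne_top`, `nobleXiBT_le_bound` of `LaceExpansionNobleContinuity.lean`).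
* `NobleRelationSummedAt d p` — the `κ`-SUMMED relations with the non-backtracking count `2d − 1`:
  `Σ_κ Ψ^{(N),κ}_p(x) ≤ (2d−1)(p/μ_p) Ξ^{(N)}_p(x)` ([FvdH17] §6.1 of arXiv v2 = proof of the bounds for
  `N = 1`, the display following the bound on `Σ_κ Ψ^{(1),κ}_{R,II}`: "For each realisation at most `2d−1`
  values of `κ` can contribute … The argument … also implies `Σ_κ Ψ^{(N),κ}_p(x) ≤ (2d−1)(p/μ_p) Ξ^{(N)}_p(x)`")
  and `Σ_κ Π^{(N),ι,κ}_p(x) ≤ (2d−1) p Ξ^{(N),ι}_p(x)` (NOT displayed in print; it is how the notebook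
  `Percolation.nb` feeds `General.nb` — conversion factors `(2d−1)/(2d)·μ̄` — and the same "at most
  `2d−1` directions contribute" count; HOME/DIVERGENCE.md D43).  A hypothesis here, not proved.
* `NobleAssumption43At d p S i` — the diagrammatic bounds (4.30)–(4.48) AT the parameter `p`, with the
  constants read off `i : BetaMap.Inputs` (one field of `Inputs` per printed constant; the per-`N`
  constants of (4.31)–(4.33) enter Appendix D only through the aggregates (4.49) and the tails
  `Σ_{N ≥ 2}`, `Σ_{N ≥ 1}`, which is how `Inputs` records them and how they are typed here), every
  `x`-sum carrying its summability (so that the `tsum`s are the printed sums), plus `Ĝ_p(k) ≥ 0` and the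
  two consequences of `f₁(p) ≤ Γ₁` that Appendix D uses for `μ` and `μ̄` ("In this and the following
  lines we bound `μ` by `Γ₁c_μ/(2d−1)`", App. D Step 1(b)): `μ_p ≤ i.mu`, `p ≤ i.mub`
  (`nobleMu_le_of_nobleF1_le` derives them from the tree's `nobleF1`).
* `PercolationNobleEquationAt d p` — the `x`-space NoBLE equations [NoBLE17] (1.24)–(1.25) for
  percolation (`G = τ_p`, `G^ι = τ^ι_p = tauOff d p e_ι`, [FvdH17] (2.14)–(2.15) with the completed
  coefficients (4.1)–(4.2) = alternating `N`-sums of the tree coefficients), with the summabilities that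
  make the sums genuine.  For percolation this is [FvdH17] Prop. 2.1 (finite `M`) plus the completion
  `M → ∞` of §3.3 ("for every `p < p_c` … `R_M → 0`"); the identities themselves are NOT restated as
  tree theorems (oracle residual V1-id) — a hypothesis here.
* `NobleInputsWF d i` — the regime of the constants in which Assumption 4.3 is stated and App. D computes
  (`β_μ ≥ 1`, `β̲_μ > 0`, every `β ≥ 0`, `μ`-bound in `[0,1)`, geometric ratio `< 1`: the tree's
  `BetaMap.Inputs.WF` of `BoundMapMonotone.lean` plus the two printed sign conditions of (4.30)).
* NAMED FACT `FitznerVanDerHofstad2016NoBLE_prop45ii_printed d` (a `Prop`, used as a hypothesis, never an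
  axiom) — the CITABLE one: for `0 < p < p_c` and constants `i` in that regime, the NoBLE equations,
  Assumptions 4.1, 4.2 and 4.3 with constants `i` imply `NobleSimplifiedFormAt d p (BetaMap.nobleBetaOfInputsPrinted d i)`
  — [NoBLE17] Prop. 4.5(ii) with Lemma 3.1 and the rewrite of §4.1 ((4.5)–(4.25)), the `β`'s being App. D
  (D.1)–(D.32) AS DISPLAYED (per-`κ` relation (4.29) only, UNRESCALED conversion factors: (D.4), (D.5),
  (D.9)–(D.14) verbatim).
* HYBRID — NOT CITABLE as a published theorem: `FitznerVanDerHofstad2016NoBLE_prop45ii d` — the same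
  implication with the extra hypothesis `NobleRelationSummedAt` (the `κ`-summed relations, D43) and the
  conclusion over `BetaMap.nobleBetaOfInputs d i` = App. D (D.1)–(D.32) AS WIRED by the published notebooks
  (conversion factors `(2d−1)/(2d)·μ̄`, `(2d−1)/(2d)·μ̄/μ` in `β_Π̂`, `β_Ψ̂`, `β_{R,Φ}`, D43; `μ̄μ` for `μ̄²` in
  (D.32), D29; see "Reading conventions" below).  Its `β`'s are SMALLER than the displayed ones, so it is
  the STRONGER statement: no printed line states it and no kernel bridge `…_printed → …` can exist
  (HOME/REFEREE.md V31.1).  It is printed Prop. 4.5(ii) + the notebooks' wiring — the class the build labels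
  "HYBRID — NOT CITABLE" (as the oracle of record `NobleImprovementInputsAt` is CONDITIONAL / NOT CITABLE);
  its cite tags are LOCATORS only.  Kept because it is the form the notebook certificate chain consumes.
* Bookkeeping (PROVED, pure logic): `nobleImprovementInputsAt_of_prop45ii` — the HYBRID fact (binder
  `hfact`), the NoBLE equations on `(p_I,p_c)`, Assumption 4.1, the summed relations, and "`f ≤ Γ` ⇒
  Assumption 4.3 with constants `i` and the weighted-diagram bounds `b`" give
  `NobleImprovementInputsAt d cμ c Γ (β-map i) b`.  This is the typed form of REFEREE V1(a): the oracle binder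
  becomes "published Prop. 4.5(ii) about tree objects + typed App. D map + the summed-relation hypothesis
  (D43) + the notebook wiring (D29) — hybrid — + the §4-shaped hypothesis whose numerals are STEP 2".

## Reading conventions (each is a DIVERGENCE.md row of the build; none is hidden in a hypothesis name)

* D29 (BetaMap): `General.nb` codes (D.32) lines 7–9 with `μ̄μ` where the journal prints `μ̄²`
  (conservative when evaluated at bounds with `i.mub ≤ i.mu`), and parametrises (D.4), (D.5),
  (D.9)–(D.14) by conversion factors `PsiToXi`, `muPiToXiIota`; `Percolation.nb` passes
  `(2d−1)/(2d)·(μ̄/μ)` and `(2d−1)/(2d)·μ̄` into `β_Π̂`, `β_Ψ̂`, `β_{R,Φ}` (the summed relations,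
  `NobleRelationSummedAt`, and exchangeability (4.28)), unrescaled values into (D.32).
* D43 (this module): App. D as displayed bounds every `κ`-sum termwise by the per-`κ` relation (4.29)
  (factor `2d`: (D.4) "`≤ 2dμ̄ Σ_N β^{(2N)}_{Ξ^ι}`", (D.9)–(D.12) "`2dμ̄ β_{Ξ^ι}/(1−μ)`"), whereas
  Assumption 4.3's own (4.34) ("`(2d−1)μ̄/(1−μ) Σ_N β^{(N)}_{Ξ^ι} < 1`"), [FvdH17] §4.2 and the notebooks
  use the non-backtracking count `2d−1`.  The HYBRID `…_prop45ii` (NOT CITABLE) follows the notebooks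
  (hypothesis `NobleRelationSummedAt`); the citable `…_prop45ii_printed` follows the displayed App. D.
* D44 (this module): (4.37), (4.46), (4.47) print the direction `1`/`e₁`; they are typed for every direction `ι` (equivalent
  under the symmetries of Assumption 4.1 and of the split, "these functions have the same symmetries as
  the original coefficients", §4.1.1), which is how App. D uses them.  (4.46) prints the weight
  `‖x − e_ι‖₂²` against the argument `x + e_ι`; typed as `Σ_x ‖x − e_ι‖₂² Ξ_{R,I}^{(0),ι}(x)`, the weight
  pattern of (4.44) and of `Percolation.nb` `Bound[XiIota,RI,0,Delta,ei]`.
* Directions `ι ∈ {±1,…,±d}` are `Fin d × Bool` (`GaussianDominationRouteNobleEquation.lean`), `e_ι` is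
  `Percolation.stepVec ι`, `−ι` is `Percolation.srev ι`; `‖x‖₂²` is `euclidNorm x ^ 2` (as in `nobleH`).

## References

* [NoBLE17] R. Fitzner, R. van der Hofstad, Probab. Theory Relat. Fields 169 (2017) 1041–1119
  (arXiv:1506.07969; journal pages below are those of the Springer (open access) version, journal page =
  1040 + PDF page, re-verified 2026-08-19): §1.3 (1.24)–(1.26) pp. 1048–1049; Def. 2.5 p. 1058, Ass. 2.6–2.7
  pp. 1059–1060; Lemma 3.1 p. 1064; §4.1 (4.1)–(4.4) and §4.1.1 (the split) pp. 1080–1081, (4.5)–(4.25)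
  pp. 1081–1085; §4.2 Assumptions 4.1–4.3, (4.26)–(4.49) pp. 1085–1088 (Ass. 4.1 (4.26)–(4.28) p. 1085,
  Ass. 4.2 pp. 1085–1086 with (4.29) p. 1086, Ass. 4.3 (4.30)–(4.37) p. 1086, (4.38)–(4.48) p. 1087, (4.49)
  p. 1088); Ass. 4.4 and Prop. 4.5 p. 1088; App. D (D.1)–(D.32) pp. 1110–1118.
* [FvdH17] R. Fitzner, R. van der Hofstad, Electron. J. Probab. 22 (2017) no. 43 (arXiv:1506.07977):
  Prop. 2.1 (2.14)–(2.18) p. 10; §3.3 (completion, (3.40)–(3.57)) pp. 25–30; §3.5 (verification of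
  Assumptions 4.1–4.2, (3.74)) pp. 29–30; §6.1 of arXiv v2 (proof of the `N = 1` bounds: the summed
  `Ψ`-relation with `2d−1`); §2.5 and the notebooks `General.nb`, `Percolation.nb`
  (https://www.win.tue.nl/~rhofstad/NoBLE/).
-/

noncomputable section

namespace Literature.Probability.FitznerVanDerHofstad2017

open Literature.Barriers.CriticalPhenomena Literature.Probability.Percolation
open Literature.Probability.LatticeModels
open scoped BigOperators ENNReal

variable {d : ℕ}

-- `e_ι ∈ ℤ^d` for a direction `ι = (j, ±) ∈ {±1,…,±d}` is the tree's `Percolation.stepVec ι`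
-- (notation local to this file; `LatticeModels.stepVec` on `Dir d` is `rfl`-equal), `−ι` is `srev ι`.
local notation "𝐞" => Literature.Probability.Percolation.stepVec

/-! ### Total rotational symmetry ([NoBLE17] Def. 2.5) and sums with their summability -/

/-- `p(x;ν,δ)` of [NoBLE17] Def. 2.5: `(p(x;ν,δ))_j = δ_j x_{ν_j}` for a permutation `ν` of the coordinates
and signs `δ ∈ {−1,1}^d` (`true ↦ +1`). [cite: FitznerVanDerHofstad2016NoBLE, Def. 2.5 (p. 1058)] -/
def siteSymm (ν : Equiv.Perm (Fin d)) (δ : Fin d → Bool) (x : Site d) : Site d :=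
  fun j => (if δ j then 1 else -1) * x (ν j)

/-- **Total rotational symmetry** of `f : ℤ^d → ℝ`: `f(x) = f(p(x;ν,δ))` for all `ν`, `δ`.
[cite: FitznerVanDerHofstad2016NoBLE, Def. 2.5 (p. 1058)] -/
def IsTRS (f : Site d → ℝ) : Prop :=
  ∀ (ν : Equiv.Perm (Fin d)) (δ : Fin d → Bool) (x : Site d), f (siteSymm ν δ x) = f x

/-- "`Σ_x f(x) ≤ β`" read as a genuine sum: `f` is summable and its sum is at most `β` (for the
non-negative `f` of Assumption 4.3 this is the printed inequality; without the summability conjunct a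
divergent `tsum` would be `0` and the bound vacuous). [cite: FitznerVanDerHofstad2016NoBLE, Assumption 4.3 ("we assume that Σ_N β^{(N)} < ∞")] -/
def SumLE (f : Site d → ℝ) (β : ℝ) : Prop :=
  Summable f ∧ ∑' x, f x ≤ β

/-- "`Σ_N Σ_x f^{(N)}(x) ≤ β`" read as genuine sums: every `f^{(N)}` is summable, the sequence of
`x`-sums is summable, and the double sum is at most `β` — the aggregate form (4.49) of the per-`N`
bounds (4.31)–(4.33) together with "`Σ_N β^{(N)}_• < ∞`".
[cite: FitznerVanDerHofstad2016NoBLE, Assumption 4.3 (4.31)–(4.33) (p. 1086) and (4.49) (p. 1088)] -/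
def NSumLE (f : ℕ → Site d → ℝ) (β : ℝ) : Prop :=
  (∀ N, Summable (f N)) ∧ Summable (fun N => ∑' x, f N x) ∧ ∑' N, ∑' x, f N x ≤ β

/-! ### The completed NoBLE coefficients (4.1)–(4.2) and the `x`-space NoBLE equations (1.24)–(1.25) -/

/-- `Ξ_p(x) = Σ_N (−1)^N Ξ^{(N)}_p(x)`. [cite: FitznerVanDerHofstad2016NoBLE, (4.1) (p. 1080)] [cite: FitznerVanDerHofstad2017, (3.44)–(3.45) (M → ∞)] -/
def nobleXi (d : ℕ) (p : unitInterval) (x : Site d) : ℝ :=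
  ∑' N, (-1 : ℝ) ^ N * nobleXiN d p N x

/-- `Ψ^κ_p(x) = Σ_N (−1)^N Ψ^{(N),κ}_p(x)`. [cite: FitznerVanDerHofstad2016NoBLE, (4.2) (p. 1080)] [cite: FitznerVanDerHofstad2017, (2.17), (3.44)] -/
def noblePsi (d : ℕ) (p : unitInterval) (κ : Fin d × Bool) (x : Site d) : ℝ :=
  ∑' N, (-1 : ℝ) ^ N * noblePsiN d p (𝐞 κ) N x

/-- `Ξ^ι_p(x) = Σ_N (−1)^N Ξ^{(N),ι}_p(x)`. [cite: FitznerVanDerHofstad2016NoBLE, (4.1) (p. 1080)] [cite: FitznerVanDerHofstad2017, (3.53)–(3.55)] -/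
def nobleXiIota (d : ℕ) (p : unitInterval) (ι : Fin d × Bool) (x : Site d) : ℝ :=
  ∑' N, (-1 : ℝ) ^ N * nobleXiIotaN d p (𝐞 ι) N x

/-- `Π^{ι,κ}_p(x) = Σ_N (−1)^N Π^{(N),ι,κ}_p(x)`. [cite: FitznerVanDerHofstad2016NoBLE, (4.2) (p. 1080)] [cite: FitznerVanDerHofstad2017, (2.16), (3.53)–(3.56)] -/
def noblePi (d : ℕ) (p : unitInterval) (ι κ : Fin d × Bool) (x : Site d) : ℝ :=
  ∑' N, (-1 : ℝ) ^ N * noblePiN d p (𝐞 ι) (𝐞 κ) N x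

/-- **The `x`-space NoBLE equations for percolation at `p`** ([NoBLE17] (1.24)–(1.25) with `G_z = τ_p`,
`G^ι_z = τ^ι_p`, `μ_z = μ_p`; [FvdH17] (2.14)–(2.15) in the limit `M → ∞`):
`τ(x) = δ_{0,x} + Ξ(x) + μ_p Σ_y Σ_ι (δ_{0,y} + Ψ^ι(y)) τ^ι(x − y + e_ι)` and, for every `ι`,
`τ(x) = τ^ι(x) + μ_p τ^{−ι}(x − e_ι) + Σ_y Σ_κ Π^{ι,κ}(y) τ^κ(x − y + e_κ) + Ξ^ι(x)`, together with the
(absolute) convergence of the alternating `N`-series (4.1)–(4.2) and of the `y`-sums.  For percolation: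
[FvdH17] Prop. 2.1 for finite `M` with remainders `R_M`, `R^ι_M`, and §3.3 ("for every `p < p_c` …
`R_M(x) → 0`").  NOT a tree theorem (the identities of Prop. 2.1 / Lemma 3.3 are not restated in the
tree); a hypothesis of the named fact below.
[cite: FitznerVanDerHofstad2016NoBLE, (1.24)–(1.26) (pp. 1048–1049)] [cite: FitznerVanDerHofstad2017, Prop. 2.1 (2.14)–(2.18) (pp. 10–11; EJP 22 (2017) no. 43 p. 10); §3.3 (3.40)–(3.57) (pp. 25–30)] -/
structure PercolationNobleEquationAt (d : ℕ) (p : unitInterval) : Prop where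
  /-- `Σ_N Ξ^{(N)}_p(x) < ∞`. -/
  summableN_xi : ∀ x, Summable (fun N => nobleXiN d p N x)
  /-- `Σ_N Ψ^{(N),κ}_p(x) < ∞`. -/
  summableN_psi : ∀ κ x, Summable (fun N => noblePsiN d p (𝐞 κ) N x)
  /-- `Σ_N Ξ^{(N),ι}_p(x) < ∞`. -/
  summableN_xiIota : ∀ ι x, Summable (fun N => nobleXiIotaN d p (𝐞 ι) N x)
  /-- `Σ_N Π^{(N),ι,κ}_p(x) < ∞`. -/
  summableN_pi : ∀ ι κ x, Summable (fun N => noblePiN d p (𝐞 ι) (𝐞 κ) N x)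
  /-- the `y`-sum of (1.24) converges absolutely. -/
  summable_psi_conv : ∀ x, Summable (fun y => ∑ ι, |noblePsi d p ι y| * tauOff d p (𝐞 ι) (x - y + 𝐞 ι))
  /-- the `y`-sum of (1.25) converges absolutely. -/
  summable_pi_conv : ∀ ι x,
    Summable (fun y => ∑ κ, |noblePi d p ι κ y| * tauOff d p (𝐞 κ) (x - y + 𝐞 κ))
  /-- (1.24): `τ(x) = δ_{0,x} + Ξ(x) + μ_p [Σ_ι τ^ι(x + e_ι) + Σ_y Σ_ι Ψ^ι(y) τ^ι(x − y + e_ι)]`. -/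
  eq_one : ∀ x, tau d p 0 x = (if x = 0 then 1 else 0) + nobleXi d p x +
    nobleMu d p * (∑ ι, tauOff d p (𝐞 ι) (x + 𝐞 ι) +
      ∑' y, ∑ ι, noblePsi d p ι y * tauOff d p (𝐞 ι) (x - y + 𝐞 ι))
  /-- (1.25): `τ(x) = τ^ι(x) + μ_p τ^{−ι}(x − e_ι) + Σ_y Σ_κ Π^{ι,κ}(y) τ^κ(x − y + e_κ) + Ξ^ι(x)`. -/
  eq_two : ∀ ι x, tau d p 0 x = tauOff d p (𝐞 ι) x + nobleMu d p * tauOff d p (𝐞 (srev ι)) (x - 𝐞 ι) +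
    (∑' y, ∑ κ, noblePi d p ι κ y * tauOff d p (𝐞 κ) (x - y + 𝐞 κ)) + nobleXiIota d p ι x

/-! ### The model-dependent split of [NoBLE17] §4.1.1 -/

/-- **The split of the coefficients** ([NoBLE17] §4.1.1, p. 1081): "non-negative functions"
`Ξ_α^{(0)}, Ξ_α^{(1)}, Ψ_{α,I}^{(0),ι}, Ψ_{α,II}^{(0),ι}, Ψ_{α,I}^{(1),ι}, Ψ_{α,II}^{(1),ι}, Ξ_{α,I}^{(0),ι},
Ξ_{α,II}^{(0),ι}, Π_α^{(0),ι,κ}` and (non-negative) remainders with `Ξ^{(N)} = Ξ_α^{(N)} + Ξ_R^{(N)}`,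
`Ψ^{(N),ι} = Ψ_{α,I}^{(N),ι} + Ψ_{R,I}^{(N),ι} = Ψ_{α,II}^{(N),ι} + Ψ_{R,II}^{(N),ι}`,
`Ξ^{(0),ι} = Ξ_{α,I}^{(0),ι} + Ξ_{R,I}^{(0),ι} = Ξ_{α,II}^{(0),ι} + Ξ_{R,II}^{(0),ι}`,
`Π^{(0),ι,κ} = Π_α^{(0),ι,κ} + Π_R^{(0),ι,κ}` (`N = 0,1`), and, for `‖x‖₂ > 1`: `Ξ_α^{(N)}(x) = 0`,
`Ψ_{α,I}^{(N),ι}(x + e_ι) = 0`, `Ψ_{α,II}^{(N),ι}(x) = 0`, `Ξ_{α,I}^{(0),ι}(x + e_ι) = 0`, `Ξ_{α,II}^{(0),ι}(x) = 0`;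
`Π_α^{(0),ι,κ}(x) = 0` for `x ∉ {e_ι, e_ι + e_κ}`.  The `α`-parts are DATA (model-dependent; for
percolation [FvdH17] §3.4), the remainders are the differences (`NobleSplit.xiR`, …); the `N`-indexed
fields are constrained (and used) for `N ≤ 1` only.
[cite: FitznerVanDerHofstad2016NoBLE, §4.1.1 (pp. 1080–1081)] [cite: FitznerVanDerHofstad2017, §3.4 and §4.1 ("we define the remainder terms by Ξ_R := Ξ − Ξ_α")] -/
structure NobleSplit (d : ℕ) (p : unitInterval) where
  /-- `Ξ_α^{(N)}` (`N = 0,1`). -/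
  xiA : ℕ → Site d → ℝ
  /-- `Ψ_{α,I}^{(N),ι}` (`N = 0,1`). -/
  psiAI : ℕ → Fin d × Bool → Site d → ℝ
  /-- `Ψ_{α,II}^{(N),ι}` (`N = 0,1`). -/
  psiAII : ℕ → Fin d × Bool → Site d → ℝ
  /-- `Ξ_{α,I}^{(0),ι}`. -/
  xiIotaAI : Fin d × Bool → Site d → ℝ
  /-- `Ξ_{α,II}^{(0),ι}`. -/
  xiIotaAII : Fin d × Bool → Site d → ℝ
  /-- `Π_α^{(0),ι,κ}`. -/
  piA : Fin d × Bool → Fin d × Bool → Site d → ℝ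
  xiA_nonneg : ∀ N ≤ 1, ∀ x, 0 ≤ xiA N x
  xiA_le : ∀ N ≤ 1, ∀ x, xiA N x ≤ nobleXiN d p N x
  xiA_support : ∀ N ≤ 1, ∀ x, 1 < euclidNorm x → xiA N x = 0
  psiAI_nonneg : ∀ N ≤ 1, ∀ ι x, 0 ≤ psiAI N ι x
  psiAI_le : ∀ N ≤ 1, ∀ ι x, psiAI N ι x ≤ noblePsiN d p (𝐞 ι) N x
  psiAI_support : ∀ N ≤ 1, ∀ ι x, 1 < euclidNorm x → psiAI N ι (x + 𝐞 ι) = 0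
  psiAII_nonneg : ∀ N ≤ 1, ∀ ι x, 0 ≤ psiAII N ι x
  psiAII_le : ∀ N ≤ 1, ∀ ι x, psiAII N ι x ≤ noblePsiN d p (𝐞 ι) N x
  psiAII_support : ∀ N ≤ 1, ∀ ι x, 1 < euclidNorm x → psiAII N ι x = 0
  xiIotaAI_nonneg : ∀ ι x, 0 ≤ xiIotaAI ι x
  xiIotaAI_le : ∀ ι x, xiIotaAI ι x ≤ nobleXiIotaN d p (𝐞 ι) 0 x
  xiIotaAI_support : ∀ ι x, 1 < euclidNorm x → xiIotaAI ι (x + 𝐞 ι) = 0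
  xiIotaAII_nonneg : ∀ ι x, 0 ≤ xiIotaAII ι x
  xiIotaAII_le : ∀ ι x, xiIotaAII ι x ≤ nobleXiIotaN d p (𝐞 ι) 0 x
  xiIotaAII_support : ∀ ι x, 1 < euclidNorm x → xiIotaAII ι x = 0
  piA_nonneg : ∀ ι κ x, 0 ≤ piA ι κ x
  piA_le : ∀ ι κ x, piA ι κ x ≤ noblePiN d p (𝐞 ι) (𝐞 κ) 0 x
  piA_support : ∀ ι κ x, x ≠ 𝐞 ι → x ≠ 𝐞 ι + 𝐞 κ → piA ι κ x = 0

namespace NobleSplit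

variable {p : unitInterval} (S : NobleSplit d p)

/-- `Ξ_R^{(N)} := Ξ^{(N)} − Ξ_α^{(N)}`. [cite: FitznerVanDerHofstad2016NoBLE, §4.1.1 (pp. 1080–1081)] -/
def xiR (N : ℕ) (x : Site d) : ℝ := nobleXiN d p N x - S.xiA N x

/-- `Ψ_{R,I}^{(N),ι} := Ψ^{(N),ι} − Ψ_{α,I}^{(N),ι}`. [cite: FitznerVanDerHofstad2016NoBLE, §4.1.1 (pp. 1080–1081)] -/
def psiRI (N : ℕ) (ι : Fin d × Bool) (x : Site d) : ℝ := noblePsiN d p (𝐞 ι) N x - S.psiAI N ι x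

/-- `Ψ_{R,II}^{(N),ι} := Ψ^{(N),ι} − Ψ_{α,II}^{(N),ι}`. [cite: FitznerVanDerHofstad2016NoBLE, §4.1.1 (pp. 1080–1081)] -/
def psiRII (N : ℕ) (ι : Fin d × Bool) (x : Site d) : ℝ := noblePsiN d p (𝐞 ι) N x - S.psiAII N ι x

/-- `Ξ_{R,I}^{(0),ι} := Ξ^{(0),ι} − Ξ_{α,I}^{(0),ι}`. [cite: FitznerVanDerHofstad2016NoBLE, §4.1.1 (pp. 1080–1081)] -/
def xiIotaRI (ι : Fin d × Bool) (x : Site d) : ℝ := nobleXiIotaN d p (𝐞 ι) 0 x - S.xiIotaAI ι x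

/-- `Ξ_{R,II}^{(0),ι} := Ξ^{(0),ι} − Ξ_{α,II}^{(0),ι}`. [cite: FitznerVanDerHofstad2016NoBLE, §4.1.1 (pp. 1080–1081)] -/
def xiIotaRII (ι : Fin d × Bool) (x : Site d) : ℝ := nobleXiIotaN d p (𝐞 ι) 0 x - S.xiIotaAII ι x

/-- `Π_R^{(0),ι,κ} := Π^{(0),ι,κ} − Π_α^{(0),ι,κ}`. [cite: FitznerVanDerHofstad2016NoBLE, §4.1.1 (pp. 1080–1081)] -/
def piR (ι κ : Fin d × Bool) (x : Site d) : ℝ := noblePiN d p (𝐞 ι) (𝐞 κ) 0 x - S.piA ι κ x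

/-- The remainders are non-negative (the `α`-parts are dominated by the coefficients). [cite: FitznerVanDerHofstad2016NoBLE, §4.1.1 ("non-negative functions")] -/
theorem xiR_nonneg {N : ℕ} (hN : N ≤ 1) (x : Site d) : 0 ≤ S.xiR N x :=
  sub_nonneg.2 (S.xiA_le N hN x)

/-- `Π_R ≥ 0`. [cite: FitznerVanDerHofstad2016NoBLE, §4.1.1 ("non-negative functions")] -/
theorem piR_nonneg (ι κ : Fin d × Bool) (x : Site d) : 0 ≤ S.piR ι κ x :=
  sub_nonneg.2 (S.piA_le ι κ x)

end NobleSplit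

/-! ### Assumption 4.1 (symmetry) -/

/-- **[NoBLE17] Assumption 4.1 (Symmetry of the models) for percolation at `p`, for the split `S`**:
the reflection symmetries `Ξ^{(N)}(x) = Ξ^{(N)}(−x)`, `Ψ^{(N),ι}(x) = Ψ^{(N),−ι}(−x)`,
`Ξ^{(N),ι}(x) = Ξ^{(N),−ι}(−x)`, `Π^{(N),ι,κ}(x) = Π^{(N),−ι,−κ}(−x)`; total rotational symmetry of
`Ξ^{(N)}`, `Σ_ι Ψ^{(N),ι}`, `Σ_ι Ξ^{(N),ι}`, `Σ_{ι,κ} Π^{(N),ι,κ}` (4.26) and of the remainder sums (4.27);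
exchangeability of the directions (4.28).  For percolation "easy to see" ([FvdH17] §3.5); NOT a tree
theorem — a hypothesis.
[cite: FitznerVanDerHofstad2016NoBLE, Assumption 4.1, (4.26)–(4.28) (p. 1085)] [cite: FitznerVanDerHofstad2017, §3.5 (verification for percolation)] -/
structure NobleAssumption41At (d : ℕ) (p : unitInterval) (S : NobleSplit d p) : Prop where
  xi_refl : ∀ N x, nobleXiN d p N x = nobleXiN d p N (-x)
  psi_refl : ∀ N ι x, noblePsiN d p (𝐞 ι) N x = noblePsiN d p (𝐞 (srev ι)) N (-x)
  xiIota_refl : ∀ N ι x, nobleXiIotaN d p (𝐞 ι) N x = nobleXiIotaN d p (𝐞 (srev ι)) N (-x)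
  pi_refl : ∀ N ι κ x, noblePiN d p (𝐞 ι) (𝐞 κ) N x = noblePiN d p (𝐞 (srev ι)) (𝐞 (srev κ)) N (-x)
  /-- (4.26) -/
  xi_trs : ∀ N, IsTRS (nobleXiN d p N)
  psiSum_trs : ∀ N, IsTRS (fun x => ∑ ι, noblePsiN d p (𝐞 ι) N x)
  xiIotaSum_trs : ∀ N, IsTRS (fun x => ∑ ι, nobleXiIotaN d p (𝐞 ι) N x)
  piSum_trs : ∀ N, IsTRS (fun x => ∑ ι, ∑ κ, noblePiN d p (𝐞 ι) (𝐞 κ) N x)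
  /-- (4.27) -/
  xiR_trs : ∀ N ≤ 1, IsTRS (S.xiR N)
  psiRISum_trs : ∀ N ≤ 1, IsTRS (fun x => ∑ ι, S.psiRI N ι x)
  psiRIISum_trs : ∀ N ≤ 1, IsTRS (fun x => ∑ ι, S.psiRII N ι x)
  xiIotaRISum_trs : IsTRS (fun x => ∑ ι, S.xiIotaRI ι x)
  xiIotaRIISum_trs : IsTRS (fun x => ∑ ι, S.xiIotaRII ι x)
  piRSum_trs : IsTRS (fun x => ∑ ι, ∑ κ, S.piR ι κ x)
  /-- (4.28): `Ψ̂^{(N),ι}(0) = Ψ̂^{(N),κ}(0)`. -/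
  psi_exch : ∀ N ι κ, ∑' x, noblePsiN d p (𝐞 ι) N x = ∑' x, noblePsiN d p (𝐞 κ) N x
  /-- (4.28): `Ξ̂^{(N),ι}(0) = Ξ̂^{(N),κ}(0)`. -/
  xiIota_exch : ∀ N ι κ, ∑' x, nobleXiIotaN d p (𝐞 ι) N x = ∑' x, nobleXiIotaN d p (𝐞 κ) N x
  /-- (4.28): `Σ_{κ'} Π̂^{(N),ι,κ'}(0) = Σ_{ι'} Π̂^{(N),ι',κ}(0)`. -/
  pi_exch : ∀ N ι κ, ∑ κ', ∑' x, noblePiN d p (𝐞 ι) (𝐞 κ') N x = ∑ ι', ∑' x, noblePiN d p (𝐞 ι') (𝐞 κ) N x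

/-! ### Assumption 4.2 (relation between coefficients) — proved for percolation -/

/-- **[NoBLE17] Assumption 4.2 (Relation between coefficients) for percolation at `p`** (`μ̄_p = p`,
`μ_p = nobleMu d p`): `Ψ^{(N),κ}_p(x) ≤ (p/μ_p) Ξ^{(N)}_p(x)` and `Π^{(N),ι,κ}_p(x) ≤ p Ξ^{(N),ι}_p(x)` for all
`x`, `N`, `ι`, `κ`. [cite: FitznerVanDerHofstad2016NoBLE, Assumption 4.2 (p. 1085), (4.29) (p. 1086)] [cite: FitznerVanDerHofstad2017, §3.5 (3.74)] -/
def NobleAssumption42At (d : ℕ) (p : unitInterval) : Prop :=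
  (∀ (N : ℕ) (κ : Fin d × Bool) (x : Site d),
      noblePsiN d p (𝐞 κ) N x ≤ (p : ℝ) / nobleMu d p * nobleXiN d p N x) ∧
    ∀ (N : ℕ) (ι κ : Fin d × Bool) (x : Site d),
      noblePiN d p (𝐞 ι) (𝐞 κ) N x ≤ (p : ℝ) * nobleXiIotaN d p (𝐞 ι) N x

/-- `Ξ^{(N)}_p(x) < ∞` for `p < p_c` (`d ≥ 2`). [cite: FitznerVanDerHofstad2017, (3.34)–(3.35), (3.43)] -/
theorem nobleXiT_ne_top (hd : 2 ≤ d) {p : unitInterval} (hp : p < criticalProbI d) (N : ℕ) (x : Site d) :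
    nobleXiT d p N x ≠ ∞ := by
  unfold nobleXiT
  split_ifs
  · exact ENNReal.zero_ne_top
  · exact nobleXiBT_ne_top hd ∅ ∅ N {0} 0 x hp

/-- `Ξ^{(N),ι}_p(x) < ∞` for `p < p_c` (`d ≥ 2`): both summands of (3.55) are bounded by the level bound
`(2dpχ(p))^N`. [cite: FitznerVanDerHofstad2017, (3.34)–(3.35), (3.53), (3.55)] -/
theorem nobleXiIotaT_ne_top (hd : 2 ≤ d) {p : unitInterval} (hp : p < criticalProbI d) (e : Site d) :
    ∀ (N : ℕ) (x : Site d), nobleXiIotaT d p e N x ≠ ∞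
  | 0, x => nobleXiBT_ne_top hd {s(0, e)} ∅ 0 {e} 0 x hp
  | N + 1, x => by
    show nobleXiBT d p {s(0, e)} ∅ (N + 1) {e} 0 x +
        ENNReal.ofReal p * nobleIotaCorr d p e (fun C => nobleXiBT d p (bondsAt {0}) {0} N C e x) ≠ ∞
    exact ENNReal.add_ne_top.2 ⟨nobleXiBT_ne_top hd {s(0, e)} ∅ (N + 1) {e} 0 x hp,
      ENNReal.mul_ne_top ENNReal.ofReal_ne_top
        (nobleIotaCorr_ne_top_of_le (nobleLevelBound_ne_top p N) fun C =>
          nobleXiBT_le_bound hd le_rfl (coe_lt_criticalProb_of_lt hp) (bondsAt {0}) {0} N C e x)⟩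

/-- **Assumption 4.2 HOLDS for percolation** on `0 < p < p_c` (`d ≥ 2`): from the tree theorems
`noblePsiN_le`, `noblePiN_le` (one more indicator, [FvdH17] §3.5) and the finiteness of the coefficients
below `p_c`. [cite: FitznerVanDerHofstad2017, §3.5 (3.74) (EJP pp. 29–30)] [cite: FitznerVanDerHofstad2016NoBLE, Assumption 4.2 (pp. 1085–1086)] -/
theorem nobleAssumption42At_of_lt_criticalProbI (hd : 2 ≤ d) {p : unitInterval} (hp0 : 0 < (p : ℝ))
    (hp : p < criticalProbI d) : NobleAssumption42At d p := by
  have hp1 : (p : ℝ) < 1 :=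
    lt_of_lt_of_le (show (p : ℝ) < (criticalProbI d : ℝ) by exact_mod_cast hp) (criticalProbI d).2.2
  have hμ : 0 ≤ (p : ℝ) / nobleMu d p := div_nonneg hp0.le (nobleMu_pos (by omega) hp0 hp1).le
  exact ⟨fun N κ x => noblePsiN_le p (𝐞 κ) N x hμ (nobleXiT_ne_top hd hp N x),
    fun N ι κ x => noblePiN_le p (𝐞 ι) (𝐞 κ) N x (nobleXiIotaT_ne_top hd hp (𝐞 ι) N x)⟩

/-- **The `κ`-summed relations with the non-backtracking count** at `p`:
`Σ_κ Ψ^{(N),κ}_p(x) ≤ (2d−1)(p/μ_p) Ξ^{(N)}_p(x)` and `Σ_κ Π^{(N),ι,κ}_p(x) ≤ (2d−1) p Ξ^{(N),ι}_p(x)` (at most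
`2d−1` of the `2d` directions `κ` contribute, the step back onto the last pivotal bond being excluded).
The `Ψ`-relation is displayed in [FvdH17] (§6.1 of arXiv v2, proof of the bounds for `N = 1`: "For each
realisation at most `2d−1` values of `κ` can contribute … The argument … also implies that
`Σ_κ Ψ^{(N),κ}_p(x) ≤ (2d−1)(p/μ_p) Ξ^{(N)}_p(x)`"); the `Π`-relation is NOT displayed (§5: the bounds on
`Π^{(N),ι,κ}` "follow from" the per-`κ` relation (3.74)) and is how `Percolation.nb` wires the conversion
factor `(2d−1)/(2d)·μ̄` into `General.nb` (HOME/DIVERGENCE.md D43).  A hypothesis of this file; it is PROVED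
for `2 ≤ d`, `0 < p < p_c` downstream, in `NobleRelationSummed` (`nobleRelationSummedAt_of_lt_criticalProbI`,
which imports this module).
[cite: FitznerVanDerHofstad2017, §6.1 (arXiv v2; proof of the N = 1 bounds, display "Σ_κ Ψ^{(N),κ}_p(x) ≤ (2d−1)(p/μ_p)Ξ^{(N)}_p(x)"); §5 ("Bounds on Ψ^{(N),κ} and Π^{(N),ι,κ} follow from (3.74)"); §2.5 notebook Percolation.nb (PsiToXi, muPiToXiIota = (2d−1)/(2d)·…)] -/
def NobleRelationSummedAt (d : ℕ) (p : unitInterval) : Prop :=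
  (∀ (N : ℕ) (x : Site d),
      ∑ κ, noblePsiN d p (𝐞 κ) N x ≤ (2 * d - 1) * ((p : ℝ) / nobleMu d p) * nobleXiN d p N x) ∧
    ∀ (N : ℕ) (ι : Fin d × Bool) (x : Site d),
      ∑ κ, noblePiN d p (𝐞 ι) (𝐞 κ) N x ≤ (2 * d - 1) * (p : ℝ) * nobleXiIotaN d p (𝐞 ι) N x

/-! ### Assumption 4.3 (diagrammatic bounds) at `p`, constants read off `i : BetaMap.Inputs` -/

/-- **[NoBLE17] Assumption 4.3 (Diagrammatic bounds) for percolation AT the parameter `p`, for the split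
`S`, with the constants `i : BetaMap.Inputs`** — the CONCLUSIONS of Assumption 4.3 (the printed
assumption is "if `f_i(z) ≤ Γ_i` then these bounds hold"; the antecedent is supplied by the user, see
`nobleImprovementInputsAt_of_prop45ii`).  Field ↔ display: `tauHat_nonneg` "`Ĝ_z(k) ≥ 0`";
`mubOverMu`/`muMin` (4.30); `mu_le`/`mub_le` App. D Step 1 ("we bound `μ` by `Γ₁c_μ/(2d−1)`") —
the consequences of `f₁(p) ≤ Γ₁` for `μ_p`, `μ̄_p = p` (`nobleMu_le_of_nobleF1_le`); `xi*`, `xiIota*`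
(4.31) in the aggregate form (4.49) (abs/odd/even) with the tails `Σ_{N even ≥ 2}`, `Σ_{N odd ≥ 3}`;
`xiDelta*`, `xiIotaDeltaZero*` (4.32) and `xiIotaDeltaEi*` (4.33) likewise; `geom_lt_one` (4.34);
`psiZeroLower`/`piOneLower` (4.35); `xiAlpha*` (4.36)–(4.37); `xiIotaAlpha*` (4.38)–(4.39);
`psiAlpha*` (4.40)–(4.41); `piAlpha*` (4.42); `xiR*` (4.43); `psiRI*`/`psiRII*` (4.44)–(4.45);
`xiIotaRI*`/`xiIotaRII*` (4.46)–(4.47); `piR*` (4.48).  Direction-indexed displays are typed for every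
`ι` (the print has `e₁`/superscript `1` in (4.37), (4.46), (4.47)); every `x`-sum carries its summability
(`SumLE`, `NSumLE`).
[cite: FitznerVanDerHofstad2016NoBLE, Assumption 4.3, (4.30)–(4.49) (pp. 1086–1088); App. D Step 1 (p. 1110)] -/
structure NobleAssumption43At (d : ℕ) (p : unitInterval) (S : NobleSplit d p) (i : BetaMap.Inputs) :
    Prop where
  /-- "`Ĝ_z(k) ≥ 0` for all `k ∈ (−π,π)^d`". -/
  tauHat_nonneg : ∀ k ∈ cube d, 0 ≤ tauHat d p k
  /-- (4.30) `μ̄_z/μ_z ≤ β_μ` (as `μ̄ ≤ β_μ μ`). -/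
  mubOverMu : (p : ℝ) ≤ i.mubOverMu * nobleMu d p
  /-- (4.30) `μ_z ≥ β̲_μ`. -/
  muMin : i.muMin ≤ nobleMu d p
  /-- App. D Step 1: `μ ≤ Γ₁ c_μ/(2d−1)`-type bound used for `μ` throughout App. D (`Inputs.mu`). -/
  mu_le : nobleMu d p ≤ i.mu
  /-- the bound used for `μ̄ = p` (`Inputs.mub`). -/
  mub_le : (p : ℝ) ≤ i.mub
  /-- (4.31)/(4.49) `Σ_N Ξ̂^{(N)}(0) ≤ β^abs_Ξ`. -/
  xiAbs : NSumLE (fun N x => nobleXiN d p N x) i.xiAbs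
  /-- `Σ_N Ξ̂^{(2N+1)}(0) ≤ β^odd_Ξ`. -/
  xiOdd : NSumLE (fun N x => nobleXiN d p (2 * N + 1) x) i.xiOdd
  /-- `Σ_N Ξ̂^{(2N)}(0) ≤ β^even_Ξ`. -/
  xiEven : NSumLE (fun N x => nobleXiN d p (2 * N) x) i.xiEven
  /-- `Σ_{N ≥ 1} Ξ̂^{(2N)}(0) ≤ Bound[Xi,EvenTail]`. -/
  xiEvenTail : NSumLE (fun N x => nobleXiN d p (2 * N + 2) x) i.xiEvenTail
  /-- `Σ_{N ≥ 1} Ξ̂^{(2N+1)}(0) ≤ Bound[Xi,OddTail]`. -/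
  xiOddTail : NSumLE (fun N x => nobleXiN d p (2 * N + 3) x) i.xiOddTail
  /-- (4.32)/(4.49) `Σ_N Σ_x ‖x‖₂² Ξ^{(N)}(x) ≤ β^abs_{ΔΞ}`. -/
  xiDeltaAbs : NSumLE (fun N x => euclidNorm x ^ 2 * nobleXiN d p N x) i.xiDeltaAbs
  xiOddDelta : NSumLE (fun N x => euclidNorm x ^ 2 * nobleXiN d p (2 * N + 1) x) i.xiOddDelta
  xiEvenDelta : NSumLE (fun N x => euclidNorm x ^ 2 * nobleXiN d p (2 * N) x) i.xiEvenDelta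
  xiOddTailDelta : NSumLE (fun N x => euclidNorm x ^ 2 * nobleXiN d p (2 * N + 3) x) i.xiOddTailDelta
  xiEvenTailDelta : NSumLE (fun N x => euclidNorm x ^ 2 * nobleXiN d p (2 * N + 2) x) i.xiEvenTailDelta
  /-- (4.31)/(4.49) `Σ_N Ξ̂^{(N),ι}(0) ≤ β^abs_{Ξ^ι}` (every `ι`). -/
  xiIotaAbs : ∀ ι, NSumLE (fun N x => nobleXiIotaN d p (𝐞 ι) N x) i.xiIotaAbs
  xiIotaOdd : ∀ ι, NSumLE (fun N x => nobleXiIotaN d p (𝐞 ι) (2 * N + 1) x) i.xiIotaOdd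
  xiIotaEven : ∀ ι, NSumLE (fun N x => nobleXiIotaN d p (𝐞 ι) (2 * N) x) i.xiIotaEven
  xiIotaEvenTail : ∀ ι, NSumLE (fun N x => nobleXiIotaN d p (𝐞 ι) (2 * N + 2) x) i.xiIotaEvenTail
  /-- (4.32)/(4.49) `Σ_N Σ_x ‖x‖₂² Ξ^{(N),ι}(x) ≤ β^abs_{ΔΞ^ι,0}`. -/
  xiIotaDeltaZero : ∀ ι, NSumLE (fun N x => euclidNorm x ^ 2 * nobleXiIotaN d p (𝐞 ι) N x) i.xiIotaDeltaZero
  xiIotaOddDeltaZero : ∀ ι,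
    NSumLE (fun N x => euclidNorm x ^ 2 * nobleXiIotaN d p (𝐞 ι) (2 * N + 1) x) i.xiIotaOddDeltaZero
  xiIotaEvenDeltaZero : ∀ ι,
    NSumLE (fun N x => euclidNorm x ^ 2 * nobleXiIotaN d p (𝐞 ι) (2 * N) x) i.xiIotaEvenDeltaZero
  xiIotaEvenTailDeltaZero : ∀ ι,
    NSumLE (fun N x => euclidNorm x ^ 2 * nobleXiIotaN d p (𝐞 ι) (2 * N + 2) x) i.xiIotaEvenTailDeltaZero
  /-- (4.33)/(4.49) `Σ_N Σ_x ‖x − e_ι‖₂² Ξ^{(N),ι}(x) ≤ β^abs_{ΔΞ^ι,ι}`. -/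
  xiIotaDeltaEi : ∀ ι, NSumLE (fun N x => euclidNorm (x - 𝐞 ι) ^ 2 * nobleXiIotaN d p (𝐞 ι) N x) i.xiIotaDeltaEi
  xiIotaOddDeltaEi : ∀ ι,
    NSumLE (fun N x => euclidNorm (x - 𝐞 ι) ^ 2 * nobleXiIotaN d p (𝐞 ι) (2 * N + 1) x) i.xiIotaOddDeltaEi
  xiIotaEvenDeltaEi : ∀ ι,
    NSumLE (fun N x => euclidNorm (x - 𝐞 ι) ^ 2 * nobleXiIotaN d p (𝐞 ι) (2 * N) x) i.xiIotaEvenDeltaEi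
  xiIotaEvenTailDeltaEi : ∀ ι,
    NSumLE (fun N x => euclidNorm (x - 𝐞 ι) ^ 2 * nobleXiIotaN d p (𝐞 ι) (2 * N + 2) x)
      i.xiIotaEvenTailDeltaEi
  /-- (4.34) `(2d−1) μ̄/(1−μ) · Σ_N β^{(N)}_{Ξ^ι} < 1`. -/
  geom_lt_one : (2 * d - 1) * (p : ℝ) / (1 - nobleMu d p) * i.xiIotaAbs < 1
  /-- (4.35) `Ψ̂^{(0),ι}(0) ≥ β̲^{(0)}_Ψ`. -/
  psiZeroLower : ∀ ι, Summable (fun x => noblePsiN d p (𝐞 ι) 0 x) ∧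
    i.psiZeroLower ≤ ∑' x, noblePsiN d p (𝐞 ι) 0 x
  /-- (4.35) `Σ_κ Π̂^{(1),ι,κ}(0) ≥ β̲^{(1)}_{ΣΠ}`. -/
  piOneLower : ∀ ι, (∀ κ, Summable (fun x => noblePiN d p (𝐞 ι) (𝐞 κ) 1 x)) ∧
    i.piOneLower ≤ ∑ κ, ∑' x, noblePiN d p (𝐞 ι) (𝐞 κ) 1 x
  /-- (4.36) `−β^{(1−0)}_{Ξ_α(0)} ≤ Ξ_α^{(0)}(0) − Ξ_α^{(1)}(0) ≤ β^{(0−1)}_{Ξ_α(0)}`. -/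
  xiAlphaAtZero_lower : -i.xiAlphaOneMinusZeroAtZero ≤ S.xiA 0 0 - S.xiA 1 0
  xiAlphaAtZero_upper : S.xiA 0 0 - S.xiA 1 0 ≤ i.xiAlphaZeroMinusOneAtZero
  /-- (4.37) at `e_ι` (print: `e₁`; typed for every `ι` — reading HOME/DIVERGENCE.md D44 (a)). -/
  xiAlphaAtEi_lower : ∀ ι, -i.xiAlphaOneMinusZeroAtEi ≤ S.xiA 0 (𝐞 ι) - S.xiA 1 (𝐞 ι)
  xiAlphaAtEi_upper : ∀ ι, S.xiA 0 (𝐞 ι) - S.xiA 1 (𝐞 ι) ≤ i.xiAlphaZeroMinusOneAtEi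
  /-- (4.38) `Ξ_{α,I}^{(0),ι}(e_ι) ≤ β`, `Σ_κ Ξ_{α,I}^{(0),ι}(e_ι + e_κ) ≤ β_Σ`. -/
  xiIotaAlphaIAtEi : ∀ ι, S.xiIotaAI ι (𝐞 ι) ≤ i.xiIotaAlphaIAtEi
  xiIotaAlphaISumAroundEi : ∀ ι, ∑ κ, S.xiIotaAI ι (𝐞 ι + 𝐞 κ) ≤ i.xiIotaAlphaISumAroundEi
  /-- (4.39) `Ξ_{α,II}^{(0),ι}(0) ≤ β`, `Σ_κ Ξ_{α,II}^{(0),ι}(e_κ) ≤ β_Σ`. -/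
  xiIotaAlphaIIAtZero : ∀ ι, S.xiIotaAII ι 0 ≤ i.xiIotaAlphaIIAtZero
  xiIotaAlphaIISumAroundZero : ∀ ι, ∑ κ, S.xiIotaAII ι (𝐞 κ) ≤ i.xiIotaAlphaIISumAroundZero
  /-- (4.40) `−β^{(1−0)}_{ΣΨ_α,I} ≤ Σ_κ (Ψ_{α,I}^{(0),ι} − Ψ_{α,I}^{(1),ι})(e_ι + e_κ) ≤ β^{(0−1)}_{ΣΨ_α,I}`. -/
  psiAlphaIAroundEi_lower : ∀ ι,
    -i.psiAlphaIOneMinusZeroAroundEi ≤ ∑ κ, (S.psiAI 0 ι (𝐞 ι + 𝐞 κ) - S.psiAI 1 ι (𝐞 ι + 𝐞 κ))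
  psiAlphaIAroundEi_upper : ∀ ι,
    ∑ κ, (S.psiAI 0 ι (𝐞 ι + 𝐞 κ) - S.psiAI 1 ι (𝐞 ι + 𝐞 κ)) ≤ i.psiAlphaIZeroMinusOneAroundEi
  /-- (4.41) `−β^{(1−0)}_{ΣΨ_α,II} ≤ Σ_κ (Ψ_{α,II}^{(0),ι} − Ψ_{α,II}^{(1),ι})(e_κ) ≤ β^{(0−1)}_{ΣΨ_α,II}`. -/
  psiAlphaIIAroundZero_lower : ∀ ι,
    -i.psiAlphaIIOneMinusZeroAroundZero ≤ ∑ κ, (S.psiAII 0 ι (𝐞 κ) - S.psiAII 1 ι (𝐞 κ))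
  psiAlphaIIAroundZero_upper : ∀ ι,
    ∑ κ, (S.psiAII 0 ι (𝐞 κ) - S.psiAII 1 ι (𝐞 κ)) ≤ i.psiAlphaIIZeroMinusOneAroundZero
  /-- (4.42) `β̲^{(0)}_{ΣΠ_α} ≤ Σ_κ Π_α^{(0),ι,κ}(e_ι) ≤ β̄^{(0)}_{ΣΠ_α}`. -/
  piAlpha_lower : ∀ ι, i.piAlphaLower ≤ ∑ κ, S.piA ι κ (𝐞 ι)
  piAlpha_upper : ∀ ι, ∑ κ, S.piA ι κ (𝐞 ι) ≤ i.piAlpha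
  /-- (4.43) `Σ_x Ξ_R^{(N)}(x) ≤ β^{(N)}_{Ξ,R}`, `Σ_x ‖x‖₂² Ξ_R^{(N)}(x) ≤ β^{(N)}_{ΔΞ,R}` (`N = 0,1`). -/
  xiR0 : SumLE (S.xiR 0) i.xiR0
  xiR1 : SumLE (S.xiR 1) i.xiR1
  xiR0Delta : SumLE (fun x => euclidNorm x ^ 2 * S.xiR 0 x) i.xiR0Delta
  xiR1Delta : SumLE (fun x => euclidNorm x ^ 2 * S.xiR 1 x) i.xiR1Delta
  /-- (4.44) `Σ_x Ψ_{R,I}^{(N),ι}(x) ≤ β^{(N)}_{Ψ,R,I}`, `Σ_x ‖x − e_ι‖₂² Ψ_{R,I}^{(N),ι}(x) ≤ β^{(N)}_{ΔΨ,R,I}`. -/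
  psiRI0 : ∀ ι, SumLE (S.psiRI 0 ι) i.psiRI0
  psiRI1 : ∀ ι, SumLE (S.psiRI 1 ι) i.psiRI1
  psiRI0Delta : ∀ ι, SumLE (fun x => euclidNorm (x - 𝐞 ι) ^ 2 * S.psiRI 0 ι x) i.psiRI0Delta
  psiRI1Delta : ∀ ι, SumLE (fun x => euclidNorm (x - 𝐞 ι) ^ 2 * S.psiRI 1 ι x) i.psiRI1Delta
  /-- (4.45) `Σ_x Ψ_{R,II}^{(N),ι}(x) ≤ β^{(N)}_{Ψ,R,II}`, `Σ_x ‖x‖₂² Ψ_{R,II}^{(N),ι}(x) ≤ β^{(N)}_{ΔΨ,R,II}`. -/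
  psiRII0 : ∀ ι, SumLE (S.psiRII 0 ι) i.psiRII0
  psiRII1 : ∀ ι, SumLE (S.psiRII 1 ι) i.psiRII1
  psiRII0Delta : ∀ ι, SumLE (fun x => euclidNorm x ^ 2 * S.psiRII 0 ι x) i.psiRII0Delta
  psiRII1Delta : ∀ ι, SumLE (fun x => euclidNorm x ^ 2 * S.psiRII 1 ι x) i.psiRII1Delta
  /-- (4.46) first half `Σ_x Ξ_{R,I}^{(0),ι}(x) ≤ β^{(0)}_{Ξ^ι,R,I}` (print: superscript `1`, typed for every `ι` —
  READING recorded as HOME/DIVERGENCE.md **D44** (a)). -/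
  xiIotaRI0 : ∀ ι, SumLE (S.xiIotaRI ι) i.xiIotaRI0
  /-- (4.46) second half — DOCUMENTED DIVERGENCE **D44** (b) (HOME/DIVERGENCE.md): the print reads
  `Σ_x ‖x − e₁‖₂² Ξ_{R,I}^{(0),1}(x + e₁) ≤ β^{(0)}_{ΔΞ^ι,R,I}` (weight `‖x − e_ι‖₂²` against the SHIFTED argument
  `x + e_ι`); typed here as `Σ_x ‖x − e_ι‖₂² Ξ_{R,I}^{(0),ι}(x) ≤ β` — the weight pattern of (4.44) (`Ψ_{R,I}`:
  `‖x − e_ι‖₂²` against `x`) and of `Percolation.nb` `Bound[XiIota,RI,0,Delta,ei]` (second moment of `Ξ^{(0),ι}_{R,I}`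
  about `e_ι`), which is what App. D (D.21)/(D.29) consume.  NOT a transcription error; if the printed display is
  meant literally (second moment about `2e_ι` after the shift) the constant slot is the same `Inputs` field and only
  this docstring's reading changes. -/
  xiIotaRI0DeltaEi : ∀ ι, SumLE (fun x => euclidNorm (x - 𝐞 ι) ^ 2 * S.xiIotaRI ι x) i.xiIotaRI0DeltaEi
  /-- (4.47) `Σ_x Ξ_{R,II}^{(0),ι}(x) ≤ β^{(0)}_{Ξ^ι,R,II}`, `Σ_x ‖x‖₂² Ξ_{R,II}^{(0),ι}(x) ≤ β^{(0)}_{ΔΞ^ι,R,II}`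
  (print: superscript `1`; every `ι` — reading D44 (a)). -/
  xiIotaRII0 : ∀ ι, SumLE (S.xiIotaRII ι) i.xiIotaRII0
  xiIotaRII0DeltaZero : ∀ ι, SumLE (fun x => euclidNorm x ^ 2 * S.xiIotaRII ι x) i.xiIotaRII0DeltaZero
  /-- (4.48) `Σ_{x,ι} Π_R^{(0),ι,κ}(x) ≤ β^{(0)}_{Π,R}`. -/
  piR0 : ∀ κ, (∀ ι, Summable (S.piR ι κ)) ∧ ∑ ι, ∑' x, S.piR ι κ x ≤ i.piR0
  /-- (4.48) `Σ_{x,ι,κ} ‖x‖₂² Π_R^{(0),ι,κ}(x + e_ι + e_κ) ≤ β^{(0)}_{ΔΠ,R}`. -/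
  piR0DeltaEiEk : (∀ ι κ, Summable (fun x => euclidNorm x ^ 2 * S.piR ι κ (x + 𝐞 ι + 𝐞 κ))) ∧
    ∑ ι, ∑ κ, ∑' x, euclidNorm x ^ 2 * S.piR ι κ (x + 𝐞 ι + 𝐞 κ) ≤ i.piR0DeltaEiEk

/-- **`f₁(p) ≤ Γ₁` bounds `μ̄_p = p` and `μ_p`**: `p ≤ Γ₁/(2d−1)` and `μ_p ≤ Γ₁/((2d−1)c_μ)` (`c_μ > 0`,
`d ≥ 1`), since `f₁(p) = max{(2d−1)p, c_μ(2d−1)μ_p}` (`nobleF1`).  This is how App. D bounds `μ`, `μ̄`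
("In this and the following lines we bound `μ` by `Γ₁c_μ/(2d−1)`" — with the percolation `f₁` of [FvdH17]
(2.19) the bound reads `Γ₁/((2d−1)c_μ)`, `BetaMap.Inputs.mu`).
[cite: FitznerVanDerHofstad2016NoBLE, App. D Step 1(b) (p. 1110)] [cite: FitznerVanDerHofstad2017, (2.19) (f₁)] -/
theorem nobleMu_le_of_nobleF1_le (hd : 1 ≤ d) {cμ Γ₁ : ℝ} (hcμ : 0 < cμ) {p : unitInterval}
    (h : nobleF1 d cμ p ≤ Γ₁) :
    (p : ℝ) ≤ Γ₁ / (2 * d - 1) ∧ nobleMu d p ≤ Γ₁ / ((2 * d - 1) * cμ) := by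
  have hd' : (0 : ℝ) < 2 * d - 1 := by
    have : (1 : ℝ) ≤ d := by exact_mod_cast hd
    linarith
  have h1 : (2 * d - 1) * (p : ℝ) ≤ Γ₁ := le_trans (le_max_left _ _) h
  have h2 : cμ * (2 * d - 1) * nobleMu d p ≤ Γ₁ := le_trans (le_max_right _ _) h
  refine ⟨?_, ?_⟩
  · rw [le_div_iff₀ hd']; linarith
  · rw [le_div_iff₀ (mul_pos hd' hcμ)]
    calc nobleMu d p * ((2 * d - 1) * cμ) = cμ * (2 * d - 1) * nobleMu d p := by ring
      _ ≤ Γ₁ := h2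

/-! ### Prop. 4.5(ii): the named fact -/

/-- **The regime of the constants in which Assumption 4.3 is stated and App. D is evaluated**: [NoBLE17]
Assumption 4.3 opens "there exist `β_μ ≥ 1`, `β̲_μ > 0` such that (4.30) …" and all its `β^{(N)}_•` are `≥ 0`
(p. 1086); App. D divides by `1 − μ`, `1 − μ²` with the `μ`-bound in `[0,1)` and sums the geometric series with
ratio `2dμ̄β_{Ξ^ι}/(1−μ) < 1` ((D.21), (D.29), (D.32)).  Typed as the tree's well-formed region
`BetaMap.Inputs.WF (d : ℝ) i` (`BoundMapMonotone.lean`: every upper field `≥ 0`, `0 ≤ i.mu < 1`, `0 ≤ i.muMin < 1`,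
`2d·i.mub/(1 − i.mu)·i.xiIotaAbs < 1`) together with the two printed sign conditions of (4.30) `1 ≤ i.mubOverMu`,
`0 < i.muMin`.  Without it the named fact below would assert App. D's conclusions for sign patterns App. D never
treats (e.g. `i.muMin < 0` in (D.2), `i.mu ≥ 1` in (D.13)).
[cite: FitznerVanDerHofstad2016NoBLE, Assumption 4.3 (4.30) and "β^{(N)}_• ≥ 0" (p. 1086); App. D (D.2), (D.13), (D.21), (D.29), (D.32) (pp. 1110–1118)] -/
def NobleInputsWF (d : ℕ) (i : BetaMap.Inputs) : Prop :=
  BetaMap.Inputs.WF (d : ℝ) i ∧ 1 ≤ i.mubOverMu ∧ 0 < i.muMin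

namespace BetaMap

/-- The `β`-table of App. D with the UNRESCALED conversion factors: `General.nb`'s (D.4), (D.5),
(D.13)/(D.14) fed `μ̄` and `μ̄/μ` themselves (per-`κ` relation (4.29) times `2d` directions, as the
displayed (D.4) "`2dμ̄ Σ β^{(2N)}_{Ξ^ι}`" and (D.9)–(D.12) "`2dμ̄β_{Ξ^ι}/(1−μ)`"), all other fields as in
`nobleBetaOfInputs`.  [cite: FitznerVanDerHofstad2016NoBLE, App. D (D.1)–(D.5), (D.13)–(D.14), (D.32) (pp. 1110–1118)] -/
def nobleBetaOfInputsPrinted (d : ℝ) (i : Inputs) : NobleBeta where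
  βμ := betaMubarOverMu d i.mubOverMu
  βPi := betaPiHat d i.mub i.xiIotaEven i.piOneLower
  βΨ := betaPsiHatLower d i.mubOverMu i.xiOdd i.psiZeroLower
  cΦup := (nobleBetaOfInputs d i).cΦup
  βαΦ := (nobleBetaOfInputs d i).βαΦ
  βRΦ := betaRp d i.mu i.mubOverMu i.mub i.xiAbs (i.xiR0 + i.xiR1) (i.xiEvenTail + i.xiOddTail)
    i.xiIotaAbs (i.xiIotaOdd + i.xiIotaEvenTail) i.xiIotaRI0 i.xiIotaRII0
  αFlow := (nobleBetaOfInputs d i).αFlow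
  βΔ := (nobleBetaOfInputs d i).βΔ

/-- The printed table differs from the wired one only in `βPi`, `βΨ`, `βRΦ`. [cite: FitznerVanDerHofstad2016NoBLE, App. D (pp. 1110–1118)] -/
theorem nobleBetaOfInputsPrinted_eq (d : ℝ) (i : Inputs) :
    (nobleBetaOfInputsPrinted d i).βμ = (nobleBetaOfInputs d i).βμ ∧
      (nobleBetaOfInputsPrinted d i).cΦup = (nobleBetaOfInputs d i).cΦup ∧
      (nobleBetaOfInputsPrinted d i).βαΦ = (nobleBetaOfInputs d i).βαΦ ∧
      (nobleBetaOfInputsPrinted d i).αFlow = (nobleBetaOfInputs d i).αFlow ∧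
      (nobleBetaOfInputsPrinted d i).βΔ = (nobleBetaOfInputs d i).βΔ :=
  ⟨rfl, rfl, rfl, rfl, rfl⟩

end BetaMap

/-- HYBRID (printed Prop. 4.5(ii) + the published notebooks' wiring, D29/D43) — **NOT CITABLE as a published
theorem; the citable twin is `FitznerVanDerHofstad2016NoBLE_prop45ii_printed`** (HOME/REFEREE.md V31.1).
**[NoBLE17] Prop. 4.5(ii) for percolation, with Lemma 3.1 and the rewrite of §4.1, the `β`'s being Appendix D
AS WIRED by the notebooks** ("Assumptions 4.1–4.3 imply Assumption 2.7", proof: App. D (D.1)–(D.32)): for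
`d ≥ 2`, `0 < p < p_c` and constants `i` in the regime of Assumption 4.3 / App. D (`NobleInputsWF d i`: `β_μ ≥ 1`,
`β̲_μ > 0`, all `β ≥ 0`, `μ`-bound in `[0,1)`, geometric ratio `< 1`), if the `x`-space NoBLE equations hold at `p`
with the completed coefficients (`PercolationNobleEquationAt`), the coefficients and the split `S` have the
symmetries of Assumption 4.1, satisfy Assumption 4.2 AND the `κ`-summed relations (`NobleRelationSummedAt`,
DIVERGENCE D43 — an extra hypothesis the printed proposition does not have), and obey the bounds of Assumption 4.3
with constants `i`, then `τ̂_p` has the simplified NoBLE form with the Lemma 3.1 data and the Assumption 2.7 bounds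
with the constants `BetaMap.nobleBetaOfInputs d i` (`NobleSimplifiedFormAt`).  WHY HYBRID: the conclusion's `β`'s
carry the notebook conversion factors `(2d−1)/(2d)·μ̄`, `(2d−1)/(2d)·μ̄/μ` in `β_Π̂`, `β_Ψ̂`, `β_{R,Φ}` (D43) and
`μ̄μ` for `μ̄²` in (D.32) (D29), which are SMALLER than App. D as displayed ((D.4) "`2dμ̄ Σ_N β^{(2N)}_{Ξ^ι}`",
(D.9)–(D.12) "`2dμ̄β_{Ξ^ι}/(1−μ)`", pp. 1111–1113); the printed proof applies the per-`κ` relation (4.29) termwise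
and no printed line states this sharper conclusion, so this `Prop` is STRONGER than the printed theorem and no
kernel bridge from `…_printed` to it can exist.  By the build's ABSOLUTE RULE (a hypothesis is kernel-proved or a
verbatim quotation of a published theorem) it is therefore a HYBRID, the class labelled "HYBRID — NOT CITABLE"
(like the oracle of record `NobleImprovementInputsAt`, CONDITIONAL / NOT CITABLE).  Used as a hypothesis
`(h : FitznerVanDerHofstad2016NoBLE_prop45ii d)`, never as an axiom; NOT kernel-proved (the proof would be the
8-page computation of App. D on top of (4.5)–(4.25), run with the `2d−1` count).  The cite tags below are
LOCATORS of the printed ingredients only, not a claim that this statement is printed.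
[cite: FitznerVanDerHofstad2016NoBLE, Prop. 4.5(ii) (p. 1088); App. D (D.1)–(D.32) (pp. 1110–1118); Lemma 3.1 (p. 1064); §4.1 (4.5)–(4.25) (pp. 1081–1085); Assumption 2.7 (pp. 1059–1060) — LOCATORS ONLY (hybrid, see above)]
[cite: FitznerVanDerHofstad2017, §2.4–§2.5 (μ̄_p = p, μ_p; notebooks General.nb/Percolation.nb In[1218]–[1237]: the wiring) — LOCATORS ONLY] -/
def FitznerVanDerHofstad2016NoBLE_prop45ii (d : ℕ) : Prop :=
  2 ≤ d → ∀ (p : unitInterval) (i : BetaMap.Inputs) (S : NobleSplit d p),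
    0 < (p : ℝ) → p < criticalProbI d → NobleInputsWF d i →
    PercolationNobleEquationAt d p → NobleAssumption41At d p S → NobleAssumption42At d p →
    NobleRelationSummedAt d p → NobleAssumption43At d p S i →
    NobleSimplifiedFormAt d p (BetaMap.nobleBetaOfInputs d i)

/-- NAMED FACT (the CITABLE one) — **[NoBLE17] Prop. 4.5(ii) for percolation with Lemma 3.1 and the rewrite of
§4.1, the `β`'s being App. D AS DISPLAYED** (`BetaMap.nobleBetaOfInputsPrinted`: per-`κ` relation (4.29) only,
factor `2d` in (D.4), (D.9)–(D.12), `β_μ` unrescaled in (D.5)): for `d ≥ 2`, `0 < p < p_c` and constants `i` in the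
printed regime `NobleInputsWF d i` (`β_μ ≥ 1`, `β̲_μ > 0`, every `β ≥ 0`, `μ`-bound in `[0,1)`, ratio `< 1` — Assumption
4.3, p. 1086, and App. D (D.21), (D.29), (D.32)), the NoBLE equations at `p`, Assumption 4.1 for the split `S`,
Assumption 4.2 and Assumption 4.3 with constants `i` imply `NobleSimplifiedFormAt d p (BetaMap.nobleBetaOfInputsPrinted d i)`
("(ii) Assumptions 4.1–4.3 imply Assumption 2.7 … Part (ii) is proven using a tedious, but also straightforward,
application of the bounds stated in Assumption 4.3. We add the details of this in Appendix D", p. 1088).  Used as a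
hypothesis, never as an axiom; NOT kernel-proved.  (The hybrid `FitznerVanDerHofstad2016NoBLE_prop45ii` above is the
notebook-wired, STRONGER variant and is NOT citable.)
[cite: FitznerVanDerHofstad2016NoBLE, Prop. 4.5(ii) (p. 1088); App. D (D.1)–(D.32) (pp. 1110–1118); Lemma 3.1 (p. 1064); §4.1 (4.5)–(4.25) (pp. 1081–1085); Assumption 2.7 (pp. 1059–1060); Assumption 4.3 (4.30) (p. 1086)] -/
def FitznerVanDerHofstad2016NoBLE_prop45ii_printed (d : ℕ) : Prop :=
  2 ≤ d → ∀ (p : unitInterval) (i : BetaMap.Inputs) (S : NobleSplit d p),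
    0 < (p : ℝ) → p < criticalProbI d → NobleInputsWF d i →
    PercolationNobleEquationAt d p → NobleAssumption41At d p S → NobleAssumption42At d p →
    NobleAssumption43At d p S i →
    NobleSimplifiedFormAt d p (BetaMap.nobleBetaOfInputsPrinted d i)

/-! ### Bookkeeping: from Prop. 4.5(ii) to the oracle binder `NobleImprovementInputsAt` -/

/-- `p_I = 1/(2d−1) > 0` for `d ≥ 1`. [cite: FitznerVanDerHofstad2017, §2.4 (p_I = 1/(2d−1))] -/
theorem nbwThresholdI_pos (hd : 1 ≤ d) : 0 < (nbwThresholdI d : ℝ) := by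
  rw [coe_nbwThresholdI hd, nbwThreshold]
  have : (1 : ℝ) ≤ d := by exact_mod_cast hd
  exact div_pos one_pos (by linarith)

/-- **The improvement-step oracle binder from the notebook-wired Prop. 4.5(ii)** (pure logic).  The binder
`hfact : FitznerVanDerHofstad2016NoBLE_prop45ii d` is the HYBRID fact (printed Prop. 4.5(ii) + the published
notebooks' wiring D29/D43 — NOT CITABLE as a published theorem, see its docstring and HOME/REFEREE.md V31.1), so
this theorem's conclusion inherits that status: it is bookkeeping over a hybrid hypothesis, not a discharge of it.
Given `hfact`, the NoBLE equations and the symmetries on `(p_I, p_c)`, the summed relations there, constants `i` in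
the App. D regime (`NobleInputsWF d i`), and — under the bootstrap hypotheses `f_i(p) ≤ Γ_i` — Assumption 4.3 with
constants `i` for some split together with the weighted-diagram bounds `b` ([FvdH17] Prop. 2.2, STEP 2 of the
build), the binder `NobleImprovementInputsAt d cμ c Γ (BetaMap.nobleBetaOfInputs d i) b` holds (Assumption 4.2
itself is the tree theorem `nobleAssumption42At_of_lt_criticalProbI`).
[cite: FitznerVanDerHofstad2016NoBLE, Prop. 4.5(ii) (p. 1088) and Assumption 4.3 (pp. 1086–1088) — locators; the binder is the hybrid] [cite: FitznerVanDerHofstad2017, Prop. 2.2 and §2.4] -/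
theorem nobleImprovementInputsAt_of_prop45ii (hd : 2 ≤ d) (hfact : FitznerVanDerHofstad2016NoBLE_prop45ii d)
    {cμ : ℝ} {c : Fin 6 → ℝ} {Γ : Fin 3 → ℝ} {i : BetaMap.Inputs} {b : Fin 6 → ℝ} (hWF : NobleInputsWF d i)
    (hEq : ∀ p : unitInterval, p ∈ Set.Ioo (nbwThresholdI d) (criticalProbI d) →
      PercolationNobleEquationAt d p)
    (hSum : ∀ p : unitInterval, p ∈ Set.Ioo (nbwThresholdI d) (criticalProbI d) → NobleRelationSummedAt d p)
    (h43 : ∀ p : unitInterval, p ∈ Set.Ioo (nbwThresholdI d) (criticalProbI d) →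
      (∀ j, nobleF d cμ c j p ≤ Γ j) →
        ∃ S : NobleSplit d p, NobleAssumption41At d p S ∧ NobleAssumption43At d p S i ∧
          NobleWeightedDiagramBoundAt d p b) :
    NobleImprovementInputsAt d cμ c Γ (BetaMap.nobleBetaOfInputs d i) b := by
  intro p hp hΓ
  obtain ⟨S, h41, h43p, hW⟩ := h43 p hp hΓ
  have hp0 : 0 < (p : ℝ) :=
    lt_trans (nbwThresholdI_pos (by omega)) (show (nbwThresholdI d : ℝ) < p by exact_mod_cast hp.1)
  exact ⟨hfact hd p i S hp0 hp.2 hWF (hEq p hp) h41 (nobleAssumption42At_of_lt_criticalProbI hd hp0 hp.2)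
    (hSum p hp) h43p, hW⟩

end Literature.Probability.FitznerVanDerHofstad2017

end
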